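import Summits.QuantumFields.YangMills.Theorems.ColdStartUniversalityShenZhuZhuGradientFormSUN
import Summits.Ventures.YMGap.Thresholds.RegionHessianCalculus
import Literature.MathematicalPhysics.QuantumFieldTheory.LatticeYangMillsUniformLogSobolev
import Literature.MathematicalPhysics.QuantumLattice.LatticeGaugeDLRGibbsProofs
import Mathlib.MeasureTheory.Measure.Tilted
import HarnessLib

/-!
# UNIFORM POINCARÉ INEQUALITY FOR THE DLR KERNELS of `SU(N)` lattice Yang–Mills, every `N`, every `d`, every finite region and every
# boundary condition, at the sharp window `|β| < 1/(8d)` — Lipschitz, Γ- and printed-gradient forms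

Seat `ym-line-csu-p1` (g40), route `ColdStartUniversality` of `Summits/QuantumFields/YangMills`, helper file G32 (strong coupling; `--supports
stmt-QuantumFields-24809`).  For every finite edge set `E ⊂ ℤ^d`, every exterior configuration `η` and every smooth cylinder `F = f((U_e)_{e∈E})`, the
DLR kernel `γ_E(·|η) = ymSpecification (fundamentalRep (Fin N)) (Nβ) E η` satisfies `Var_{γ_E(·|η)}(F) ≤ (1/K)·(…)` with `K = N/2 − N|β|Λ₀` for ANY
regional Hessian constant `Λ₀` (`RegionWilsonHessianBound d N Λ₀`, the hypothesis shape of the Literature's named fact `bakryEmery_kernelLogSobolev`),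
UNIFORMLY in `E` and `η`: the POINCARÉ analogue of that named fact (the log-Sobolev version), hypothesis-free.  This is the content of the venture
`YMGap`'s leaves `Thresholds/RegionPoincare.lean`, `…/LatticeBakryEmeryGradientBridge.lean`, §1 of `…/SharpUniqueness.lean`, NOT built on the farm;
re-derived here on the venture's BUILT modules (`poincare_gibbs`, `RegionHessianCalculus`) WITHOUT new definitions (the kernel potential
`S_{E,η,β}(Q) = Nβ · regionRe (Q ∨ η) E` is written with the Literature's `glueWith` and the venture's built `regionRe`, and enters as a binder `hS`).
* §1 ★ `regionWilsonHessianBound_four_d_sun` — the regional Hessian hypothesis holds with `Λ₀ = 4d` (venture Theorem C with frozen exterior).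
* §2 `regionPot_mem_polySpace_sun` (`S ∈ 𝒫_4`), `integral_ymSpecification_eq_div_sun` (kernel expectations as `e^{S}`-weighted product-Haar averages),
  `hessBound_regionPot_sun` (`HessBound S (N|β|Λ₀)`).
* §3 ★★★ `kernel_variance_le_integral_Gam_sun` (Γ-form), ★★★ `kernel_variance_le_sun` (Lipschitz form), ★★★ `kernel_variance_le_linkGradSq_sun` (printed
  gradient form `Σ_{e∈E} ∫|∇_e F|² dγ`, Literature `linkGradSq`) — every `E`, `η`, `Λ₀`; ★★★ `uniform_kernel_poincare_sharp_sun` — `|β| < 1/(8d)`,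
  `K = N/2 − 4dN|β|`, EVERY region and boundary condition.

THEOREMS ONLY, no definition, no sorry.  WHAT IT IS NOT: no log-Sobolev inequality, no Dobrushin–Shlosman mixing / uniqueness / mass-gap statement
(those need the Stroock–Zegarlinski equivalence, a named fact); strong coupling only; nothing `K`-uniform along the route's scaling
(`UniformColdStartMixing`, 24809, ASIDE, not restated); no crux, rung or summit statement is proved; the Yang–Mills mass gap is NOT proved.
References: H. Shen, R. Zhu, X. Zhu, CMP 400 (2023) 805–851, Thm 4.2 / Remark 1.3, Lemma 4.1 [ShenZhuZhu2022]; D. W. Stroock, B. Zegarlinski,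
J. Funct. Anal. 104 (1992) 299–326, CMP 144 (1992) 303–323; Bakry–Émery, LNM 1123 (1985).
-/

set_option autoImplicit false

noncomputable section

namespace Summit.QuantumFields.YangMills.Theorems.ColdStartUniversality

open MeasureTheory ProbabilityTheory Finset Filter Set Function
open scoped BigOperators NNReal ENNReal Topology Matrix Matrix.Norms.Frobenius ContDiff
open Literature.MathematicalPhysics.QuantumFieldTheory
open Literature.MathematicalPhysics.QuantumLattice (fundamentalRep continuous_fundamentalRep fundamentalRep_apply LGConfig ZdPlaquette
  plaquettesTouching plaquetteObs plaquetteHolonomyZd wilsonBoundaryAction ymSpecification continuous_wilsonBoundaryAction)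
open Literature.Probability.LatticeModels (glueWith glueWith_apply_mem glueWith_apply_not_mem measurable_glueWith)
open Literature.MathematicalPhysics.QuantumFieldTheory.SUNBakryEmery (SUN FrameIdx frame)
open Summit.Ventures.YMGap.LatticeBakryEmery (PSU Cfg emb emb_apply haarPi Gam lk algD algD_apply linkFun linkFun_apply Gam_self_eq_sum_linkFun
  poincare_gibbs poincare_gibbs_lipschitz integrable_of_continuous_PSU continuous_restrict contDiff_Gam HessBound LinkLipschitz IsCPolyMat IsCPoly
  isCPolyMat_link polySpace const_mem_polySpace contDiff_of_mem_polySpace algD_const_mul contDiff_algD iteratedDeriv_two_comp_mul_exp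
  frobNorm_conj_unitary)
open Summit.Ventures.YMGap.HessianSharp (regionRe zperturb zplaqRe regionNormSq abs_region_second_variation_le_four_d wilsonHessianBound_four_d)

variable {d N : ℕ}

/-! ## §1. The regional Hessian hypothesis with `Λ₀ = 4d` -/

variable (d N) in
/-- ★ **The regional Hessian hypothesis of the Literature's Bakry–Émery kernel fact holds with `Λ₀ = 4d`** (venture `YMGap` Theorem C with frozen
exterior, `RegionHessianCalculus.abs_region_second_variation_le_four_d`): for every finite edge set `E`, every `U ∈ SU(N)^{E⁺(ℤ^d)}` and every
`X ∈ 𝔰𝔲(N)^{E⁺(ℤ^d)}` vanishing off `E`, `|d²/dt²|₀ Σ_{p∩E≠∅} Re tr hol_p(e^{tX}U)| ≤ 4d Σ_{e∈E} tr(X_eX_eᴴ)`.  Port of the unbuilt venture leaf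
`SharpUniqueness.regionWilsonHessianBound_four_d`. [cite: ShenZhuZhu2022, Lemma 4.1] -/
theorem regionWilsonHessianBound_four_d_sun : RegionWilsonHessianBound d N (4 * d) := by
  intro E U X hX _ hXE
  exact abs_region_second_variation_le_four_d _ X (fun e => (Matrix.mem_specialUnitaryGroup_iff.1 (U e).2).1) hX E hXE

/-! ## §2. The kernel potential `S_{E,η,β}(Q) = Nβ · regionRe (Q ∨ η) E` -/

section Potential

variable (E : Finset (Literature.MathematicalPhysics.QuantumLattice.ZdEdge d)) (η : LGConfig d (SUN N)) (β : ℝ)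

/-- Each glued link matrix `(Q ∨ η)_e` is polynomial of degree `≤ 1` in the interior variables. [folklore] -/
theorem isCPolyMat_glueWith (e : Literature.MathematicalPhysics.QuantumLattice.ZdEdge d) :
    IsCPolyMat (ι := ↥E) (N := N) 1 fun Q : Cfg ↥E N => glueWith E Q (fun e' => ((η e' : SUN N) : Matrix (Fin N) (Fin N) ℂ)) e := by
  by_cases h : e ∈ E
  · have : (fun Q : Cfg ↥E N => glueWith E Q (fun e' => ((η e' : SUN N) : Matrix (Fin N) (Fin N) ℂ)) e) = fun Q => Q ⟨e, h⟩ := by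
      funext Q; exact glueWith_apply_mem E Q _ h
    rw [this]; exact isCPolyMat_link _
  · have : (fun Q : Cfg ↥E N => glueWith E Q (fun e' => ((η e' : SUN N) : Matrix (Fin N) (Fin N) ℂ)) e) =
        fun _ => ((η e : SUN N) : Matrix (Fin N) (Fin N) ℂ) := by
      funext Q; exact glueWith_apply_not_mem E Q _ h
    rw [this]
    intro a b
    refine IsCPoly.mono (Nat.zero_le 1) ?_
    exact ⟨by show (fun _ : Cfg ↥E N => ((((η e : SUN N) : Matrix (Fin N) (Fin N) ℂ)) a b).re) ∈ _; exact const_mem_polySpace 0 _,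
      by show (fun _ : Cfg ↥E N => ((((η e : SUN N) : Matrix (Fin N) (Fin N) ℂ)) a b).im) ∈ _; exact const_mem_polySpace 0 _⟩

/-- The normalised kernel potential `Q ↦ regionRe (Q ∨ η) E` is a polynomial of degree `≤ 4` in the interior link matrices. [cite: ShenZhuZhu2022, (4.1)] -/
theorem regionRe_glueWith_mem_polySpace :
    (fun Q : Cfg ↥E N => regionRe (glueWith E Q (fun e' => ((η e' : SUN N) : Matrix (Fin N) (Fin N) ℂ))) E) ∈ polySpace ↥E N 4 := by
  set g : Cfg ↥E N → LGConfig d (Matrix (Fin N) (Fin N) ℂ) := fun Q => glueWith E Q (fun e' => ((η e' : SUN N) : Matrix (Fin N) (Fin N) ℂ)) with hg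
  have h0 : (fun Q : Cfg ↥E N => regionRe (g Q) E) = ∑ p ∈ plaquettesTouching E, fun Q : Cfg ↥E N =>
      (g Q (p.1, p.2.1.1) * g Q (p.1 + Pi.single p.2.1.1 1, p.2.1.2) * (g Q (p.1 + Pi.single p.2.1.2 1, p.2.1.1))ᴴ * (g Q (p.1, p.2.1.2))ᴴ).trace.re := by
    funext Q; simp only [regionRe, zplaqRe, Finset.sum_apply]
  show (fun Q : Cfg ↥E N => regionRe (g Q) E) ∈ polySpace ↥E N 4
  rw [h0]
  refine Submodule.sum_mem _ fun p _ => ?_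
  have h : IsCPolyMat (ι := ↥E) (N := N) (1 + 1 + 1 + 1) fun Q =>
      g Q (p.1, p.2.1.1) * g Q (p.1 + Pi.single p.2.1.1 1, p.2.1.2) * (g Q (p.1 + Pi.single p.2.1.2 1, p.2.1.1))ᴴ * (g Q (p.1, p.2.1.2))ᴴ :=
    (((isCPolyMat_glueWith E η _).mul (isCPolyMat_glueWith E η _)).mul
      (isCPolyMat_glueWith E η _).conjTranspose).mul (isCPolyMat_glueWith E η _).conjTranspose
  exact h.re_trace_mem

/-- **The kernel potential `S_{E,η,β}(Q) = Nβ · regionRe (Q ∨ η) E` is a polynomial** (degree `≤ 4`): `S_{E,η,β} ∈ 𝒫_4`. [cite: ShenZhuZhu2022, (4.1)] -/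
theorem regionPot_mem_polySpace_sun {S : Cfg ↥E N → ℝ}
    (hS : S = fun Q : Cfg ↥E N => (N : ℝ) * β * regionRe (glueWith E Q (fun e' => ((η e' : SUN N) : Matrix (Fin N) (Fin N) ℂ))) E) :
    S ∈ polySpace ↥E N 4 := by
  have : S = ((N : ℝ) * β) • fun Q : Cfg ↥E N => regionRe (glueWith E Q (fun e' => ((η e' : SUN N) : Matrix (Fin N) (Fin N) ℂ))) E := by
    rw [hS]; funext Q; simp only [Pi.smul_apply, smul_eq_mul]
  rw [this]
  exact Submodule.smul_mem _ _ (regionRe_glueWith_mem_polySpace E η)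

/-- The kernel potential is smooth. [cite: ShenZhuZhu2022, (4.1)] -/
theorem contDiff_regionPot_sun {S : Cfg ↥E N → ℝ}
    (hS : S = fun Q : Cfg ↥E N => (N : ℝ) * β * regionRe (glueWith E Q (fun e' => ((η e' : SUN N) : Matrix (Fin N) (Fin N) ℂ))) E) :
    ContDiff ℝ ∞ S :=
  contDiff_of_mem_polySpace (regionPot_mem_polySpace_sun E η β hS)

/-- The glued `SU(N)` configuration, read in `M_N(ℂ)`, is the glued matrix configuration of the embedded interior variables. [folklore] -/
theorem coe_glueWith_eq_glueWith_emb (ζ : PSU ↥E N) (e : Literature.MathematicalPhysics.QuantumLattice.ZdEdge d) :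
    ((glueWith E ζ η e : SUN N) : Matrix (Fin N) (Fin N) ℂ) = glueWith E (emb ζ) (fun e' => ((η e' : SUN N) : Matrix (Fin N) (Fin N) ℂ)) e := by
  by_cases h : e ∈ E
  · rw [glueWith_apply_mem E ζ η h, glueWith_apply_mem E (emb ζ) _ h, emb_apply]
  · rw [glueWith_apply_not_mem E ζ η h, glueWith_apply_not_mem E (emb ζ) _ h]

/-- **On glued configurations, `−(Nβ) S_E(U) = S_{E,η,β}(U_E) − N²β · #{p ∩ E ≠ ∅}`** (`S_E = wilsonBoundaryAction`, fundamental representation;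
`U⁻¹ = Uᴴ` in `SU(N)`). [cite: ShenZhuZhu2022, (4.1)] -/
theorem neg_mul_wilsonBoundaryAction_glueWith_sun {S : Cfg ↥E N → ℝ}
    (hS : S = fun Q : Cfg ↥E N => (N : ℝ) * β * regionRe (glueWith E Q (fun e' => ((η e' : SUN N) : Matrix (Fin N) (Fin N) ℂ))) E) (ζ : PSU ↥E N) :
    -((N : ℝ) * β) * wilsonBoundaryAction (fundamentalRep (Fin N)) E (glueWith E ζ η) = S (emb ζ) - (N : ℝ) * β * N * (plaquettesTouching E).card := by
  subst hS
  set g : LGConfig d (Matrix (Fin N) (Fin N) ℂ) := glueWith E (emb ζ) (fun e' => ((η e' : SUN N) : Matrix (Fin N) (Fin N) ℂ)) with hg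
  have hp : ∀ p : ZdPlaquette d, Literature.MathematicalPhysics.QuantumLattice.plaquetteObs (fundamentalRep (Fin N)) p.1 p.2.1.1 p.2.1.2 (glueWith E ζ η) =
      (g (p.1, p.2.1.1) * g (p.1 + Pi.single p.2.1.1 1, p.2.1.2) * (g (p.1 + Pi.single p.2.1.2 1, p.2.1.1))ᴴ * (g (p.1, p.2.1.2))ᴴ).trace.re := by
    intro p
    simp only [Literature.MathematicalPhysics.QuantumLattice.plaquetteObs, plaquetteHolonomyZd, map_mul, hg, ← coe_glueWith_eq_glueWith_emb]
    rfl
  show _ = (N : ℝ) * β * regionRe g E - _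
  simp only [wilsonBoundaryAction, regionRe, zplaqRe, hp, Finset.sum_sub_distrib, Finset.sum_const, nsmul_eq_mul]
  ring

/-- **DLR-kernel expectations as `e^{S}`-weighted product-Haar averages**: for continuous `F` on `ℤ^d`-configurations,
`∫ F dγ_E(·|η) = ∫ e^{S(ζ)} F(ζ ∨ η) dσ^{⊗E}(ζ) / ∫ e^{S} dσ^{⊗E}`, `S = S_{E,η,β}` (the constant `e^{−N²β #P}` cancels). [cite: ShenZhuZhu2022, Remark 1.3] -/
theorem integral_ymSpecification_eq_div_sun {S : Cfg ↥E N → ℝ}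
    (hS : S = fun Q : Cfg ↥E N => (N : ℝ) * β * regionRe (glueWith E Q (fun e' => ((η e' : SUN N) : Matrix (Fin N) (Fin N) ℂ))) E)
    {F : LGConfig d (SUN N) → ℝ} (hF : Continuous F) :
    ∫ U, F U ∂(ymSpecification (fundamentalRep (Fin N)) ((N : ℝ) * β) E η) =
      (∫ ζ, Real.exp (S (emb ζ)) * F (glueWith E ζ η) ∂(haarPi ↥E N)) / ∫ ζ, Real.exp (S (emb ζ)) ∂(haarPi ↥E N) := by
  -- adapted from Summits/Ventures/YMGap/Thresholds/RegionPoincare.lean (`integral_ymSpecification_eq_div`, unbuilt on the farm)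
  set C : ℝ := Real.exp (-((N : ℝ) * β * N * (plaquettesTouching E).card)) with hC
  have hCpos : 0 < C := Real.exp_pos _
  have hSc : Continuous fun ζ : PSU ↥E N => S (emb ζ) := continuous_restrict (contDiff_regionPot_sun E η β hS)
  have hZ'pos : 0 < ∫ ζ, Real.exp (S (emb ζ)) ∂(haarPi ↥E N) :=
    integral_exp_pos (integrable_of_continuous_PSU (Real.continuous_exp.comp hSc) _)
  set w : LGConfig d (SUN N) → ℝ := fun U =>
    Real.exp (-((N : ℝ) * β) * wilsonBoundaryAction (fundamentalRep (Fin N)) E U) with hwdef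
  have hwc : Continuous w := Real.continuous_exp.comp (continuous_const.mul
    (continuous_wilsonBoundaryAction (fundamentalRep (Fin N)) (continuous_fundamentalRep (n := Fin N)) E))
  have hw : ∀ ζ : PSU ↥E N, w (glueWith E ζ η) = C * Real.exp (S (emb ζ)) := by
    intro ζ
    simp only [hwdef]; rw [neg_mul_wilsonBoundaryAction_glueWith_sun E η β hS, ← Real.exp_add]; congr 1; ring
  have hmeas : Measurable fun ζ : PSU ↥E N => glueWith E ζ η := measurable_glueWith E η
  unfold ymSpecification
  rw [integral_tilted]
  have hZ : ∫ U, Real.exp ((fun U => -((N : ℝ) * β) * wilsonBoundaryAction (fundamentalRep (Fin N)) E U) U)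
      ∂((Measure.pi fun _ : ↥E => haarProbability (SUN N)).map fun ζ => glueWith E ζ η) = C * ∫ ζ, Real.exp (S (emb ζ)) ∂(haarPi ↥E N) := by
    rw [integral_map hmeas.aemeasurable hwc.aestronglyMeasurable]
    show ∫ ζ, w (glueWith E ζ η) ∂(haarPi ↥E N) = _
    simp_rw [hw]
    exact integral_const_mul _ _
  rw [hZ, integral_map hmeas.aemeasurable]
  · show ∫ ζ, (w (glueWith E ζ η) / (C * ∫ ζ, Real.exp (S (emb ζ)) ∂(haarPi ↥E N))) • F (glueWith E ζ η) ∂(haarPi ↥E N) = _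
    simp_rw [hw, smul_eq_mul]
    rw [eq_div_iff hZ'pos.ne', ← integral_mul_const]
    refine integral_congr_ae (ae_of_all _ fun ζ => ?_)
    have hCne : C ≠ 0 := hCpos.ne'
    have hZne : (∫ ζ, Real.exp (S (emb ζ)) ∂(haarPi ↥E N)) ≠ 0 := hZ'pos.ne'
    field_simp
  · exact ((hwc.div_const _).smul hF).aestronglyMeasurable

/-- Along the right flow `t ↦ ζ e^{tV}` at `ζ ∈ SU(N)^E`, the glued matrix configuration is the venture's exponentially perturbed configuration
`zperturb (ζ ∨ η) X t` with `X_e = ζ_e V_e ζ_eᴴ` on `E` and `X_e = 0` off `E`. [cite: ShenZhuZhu2022, (4.3)] -/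
theorem glueWith_emb_mul_exp (ζ : PSU ↥E N) (V : Cfg ↥E N) (t : ℝ) :
    glueWith E (emb ζ * NormedSpace.exp (t • V)) (fun e' => ((η e' : SUN N) : Matrix (Fin N) (Fin N) ℂ)) =
      zperturb (fun e => ((glueWith E ζ η e : SUN N) : Matrix (Fin N) (Fin N) ℂ))
        (fun e => if h : e ∈ E then (ζ ⟨e, h⟩ : Matrix (Fin N) (Fin N) ℂ) * V ⟨e, h⟩ * (ζ ⟨e, h⟩ : Matrix (Fin N) (Fin N) ℂ)ᴴ else 0) t := by
  -- adapted from RegionPoincare.regionPot₀_emb_mul_exp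
  funext e
  show _ = NormedSpace.exp (t • (if h : e ∈ E then (ζ ⟨e, h⟩ : Matrix (Fin N) (Fin N) ℂ) * V ⟨e, h⟩ * (ζ ⟨e, h⟩ : Matrix (Fin N) (Fin N) ℂ)ᴴ else 0)) *
    ((glueWith E ζ η e : SUN N) : Matrix (Fin N) (Fin N) ℂ)
  by_cases h : e ∈ E
  · rw [dif_pos h, glueWith_apply_mem E ζ η h, glueWith_apply_mem E _ _ h]
    simp only [Pi.mul_apply, show NormedSpace.exp (t • V) = fun e => NormedSpace.exp ((t • V) e) from Pi.exp_def _, Pi.smul_apply, emb_apply]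
    set Ug : Matrix (Fin N) (Fin N) ℂ := (ζ ⟨e, h⟩ : Matrix (Fin N) (Fin N) ℂ) with hUg
    have hUu : Ug ∈ Matrix.unitaryGroup (Fin N) ℂ := Matrix.specialUnitaryGroup_le_unitaryGroup (ζ ⟨e, h⟩).2
    have hstar : star Ug * Ug = 1 := Unitary.star_mul_self_of_mem hUu
    have hstar' : Ug * star Ug = 1 := Unitary.mul_star_self_of_mem hUu
    have hunit : IsUnit Ug := ⟨⟨Ug, star Ug, hstar', hstar⟩, rfl⟩
    have hinv : Ug⁻¹ = star Ug := Matrix.inv_eq_left_inv hstar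
    have hconj : t • (Ug * V ⟨e, h⟩ * Ugᴴ) = Ug * (t • V ⟨e, h⟩) * Ug⁻¹ := by
      rw [hinv, Matrix.star_eq_conjTranspose, Matrix.mul_smul, Matrix.smul_mul]
    rw [hconj, Matrix.exp_conj Ug (t • V ⟨e, h⟩) hunit, hinv, Matrix.star_eq_conjTranspose, Matrix.mul_assoc, Matrix.mul_assoc,
      show Ugᴴ * Ug = 1 from hstar, Matrix.mul_one]
  · rw [dif_neg h, glueWith_apply_not_mem E ζ η h, glueWith_apply_not_mem E _ _ h]
    simp [NormedSpace.exp_zero]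

/-- **The Hessian hypothesis for the kernel potential** from a regional Hessian bound: `RegionWilsonHessianBound d N Λ₀ → HessBound S_{E,η,β} (N|β|Λ₀)`,
for every `E` and `η`. [cite: ShenZhuZhu2022, Lemma 4.1] -/
theorem hessBound_regionPot_sun {Λ₀ : ℝ} (hH : RegionWilsonHessianBound d N Λ₀) {S : Cfg ↥E N → ℝ}
    (hS : S = fun Q : Cfg ↥E N => (N : ℝ) * β * regionRe (glueWith E Q (fun e' => ((η e' : SUN N) : Matrix (Fin N) (Fin N) ℂ))) E) :
    HessBound S ((N : ℝ) * |β| * Λ₀) := by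
  -- adapted from RegionPoincare.hessBound_regionPot
  subst hS
  intro g V hV hV0
  set η' : LGConfig d (Matrix (Fin N) (Fin N) ℂ) := fun e' => ((η e' : SUN N) : Matrix (Fin N) (Fin N) ℂ) with hη'
  set X : Literature.MathematicalPhysics.QuantumLattice.ZdEdge d → Matrix (Fin N) (Fin N) ℂ :=
    fun e => if h : e ∈ E then (g ⟨e, h⟩ : Matrix (Fin N) (Fin N) ℂ) * V ⟨e, h⟩ * (g ⟨e, h⟩ : Matrix (Fin N) (Fin N) ℂ)ᴴ else 0 with hX
  have hXskew : ∀ e, (X e)ᴴ = -X e := by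
    intro e
    by_cases h : e ∈ E
    · simp only [hX, dif_pos h, Matrix.conjTranspose_mul, Matrix.conjTranspose_conjTranspose, hV ⟨e, h⟩, Matrix.mul_neg,
        Matrix.neg_mul, Matrix.mul_assoc]
    · simp [hX, h]
  have hXtr : ∀ e, (X e).trace = 0 := by
    intro e
    by_cases h : e ∈ E
    · simp only [hX, dif_pos h]
      rw [Matrix.mul_assoc, Matrix.trace_mul_comm, Matrix.mul_assoc,
        show (g ⟨e, h⟩ : Matrix (Fin N) (Fin N) ℂ)ᴴ * (g ⟨e, h⟩ : Matrix (Fin N) (Fin N) ℂ) = 1 from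
          Unitary.star_mul_self_of_mem (Matrix.specialUnitaryGroup_le_unitaryGroup (g ⟨e, h⟩).2), Matrix.mul_one, hV0 ⟨e, h⟩]
    · simp [hX, h]
  have hXsupp : ∀ e ∉ E, X e = 0 := fun e he => by simp [hX, he]
  set P₀ : Cfg ↥E N → ℝ := fun Q => regionRe (glueWith E Q η') E with hP₀
  have hc0 : ContDiff ℝ ∞ P₀ := contDiff_of_mem_polySpace (regionRe_glueWith_mem_polySpace E η)
  set Ug : LGConfig d (Matrix (Fin N) (Fin N) ℂ) := fun e => ((glueWith E g η e : SUN N) : Matrix (Fin N) (Fin N) ℂ) with hUg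
  have hflow : (fun s : ℝ => P₀ (emb g * NormedSpace.exp (s • V))) = fun s => regionRe (zperturb Ug X s) E :=
    funext fun s => by simp only [hP₀, hη', hUg, hX]; rw [glueWith_emb_mul_exp]
  have h0 : algD V (algD V P₀) (emb g) = iteratedDeriv 2 (fun s : ℝ => regionRe (zperturb Ug X s) E) 0 := by
    rw [← iteratedDeriv_two_comp_mul_exp hc0 (emb g) V]
    exact congrArg (fun φ : ℝ → ℝ => iteratedDeriv 2 φ 0) hflow
  have h1 : algD V (algD V (fun Q : Cfg ↥E N => (N : ℝ) * β * regionRe (glueWith E Q η') E)) (emb g) =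
      (N : ℝ) * β * iteratedDeriv 2 (fun s : ℝ => regionRe (zperturb Ug X s) E) 0 := by
    have : (fun Q : Cfg ↥E N => (N : ℝ) * β * regionRe (glueWith E Q η') E) = fun Q => ((N : ℝ) * β) * P₀ Q := rfl
    rw [this, algD_const_mul hc0, algD_const_mul (contDiff_algD hc0 V)]
    show (N : ℝ) * β * algD V (algD V P₀) (emb g) = _
    rw [h0]
  rw [h1, abs_mul, abs_mul, Nat.abs_cast]
  have hb := hH E (glueWith E g η) X hXskew hXtr hXsupp
  have hdict : regionPlaquetteSumAlong E (glueWith E g η) X = fun s : ℝ => regionRe (zperturb Ug X s) E := rfl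
  have hnorm : ∑ e ∈ E, (X e * (X e)ᴴ).trace.re = ∑ e : ↥E, frobNorm (V e) ^ 2 := by
    rw [← Finset.sum_attach]
    refine Finset.sum_congr rfl fun e _ => ?_
    rw [show X (e : Literature.MathematicalPhysics.QuantumLattice.ZdEdge d) =
        (g e : Matrix (Fin N) (Fin N) ℂ) * V e * (g e : Matrix (Fin N) (Fin N) ℂ)ᴴ by simp [hX, e.2],
      ← frobNorm_conj_unitary (Matrix.specialUnitaryGroup_le_unitaryGroup (g e).2) (V e),
      frobNorm_sq_eq_re_trace, Matrix.trace_mul_comm]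
  rw [hdict, hnorm] at hb
  calc (N : ℝ) * |β| * |iteratedDeriv 2 (fun s : ℝ => regionRe (zperturb Ug X s) E) 0|
      ≤ (N : ℝ) * |β| * (Λ₀ * ∑ e, frobNorm (V e) ^ 2) :=
        mul_le_mul_of_nonneg_left hb (mul_nonneg (Nat.cast_nonneg _) (abs_nonneg _))
    _ = (N : ℝ) * |β| * Λ₀ * ∑ e, frobNorm (V e) ^ 2 := by ring

end Potential

/-! ## §3. The uniform kernel Poincaré inequality: Γ-form, Lipschitz form, printed gradient form -/

section Kernel

variable (E : Finset (Literature.MathematicalPhysics.QuantumLattice.ZdEdge d)) (η : LGConfig d (SUN N))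

/-- Cylinder functions of continuous ambient functions are continuous. [folklore] -/
theorem continuous_matrixCylinder_of_continuous {u : Cfg ↥E N → ℝ} (hu : Continuous u) :
    Continuous (matrixCylinder E u : LGConfig d (SUN N) → ℝ) :=
  hu.comp (continuous_pi fun _ => continuous_subtype_val.comp (continuous_apply _))

/-- ★★★ **Kernel Poincaré inequality, Γ (Dirichlet-form) form, EVERY region and boundary condition, every `SU(N)`, `d`, `Λ₀`**: for
`K = N/2 − N|β|Λ₀ > 0` and every smooth `f` of the interior link matrices, `Var_{γ_E(·|η)}(F) ≤ (∫ Γ(f,f) dγ_E(·|η))/K`, `F = f((U_e)_{e∈E})`, `Γ` the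
carré du champ on `SU(N)^E` — the uniform spectral gap `≥ K` of the kernels' Glauber–Langevin dynamics.  Port of the unbuilt venture
`RegionPoincare.kernel_variance_le_integral_Gam`.  The Yang–Mills mass gap is NOT proved. [cite: ShenZhuZhu2022, Theorem 4.2, Remark 1.3] -/
theorem kernel_variance_le_integral_Gam_sun {Λ₀ : ℝ} (hH : RegionWilsonHessianBound d N Λ₀) (hN : N ≠ 0) (β : ℝ)
    (hK : 0 < (N : ℝ) / 2 - N * |β| * Λ₀) {f : Cfg ↥E N → ℝ} (hf : ContDiff ℝ ∞ f) :
    Var[matrixCylinder E f; ymSpecification (fundamentalRep (Fin N)) ((N : ℝ) * β) E η] ≤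
      (∫ U, matrixCylinder E (Gam f f) U ∂(ymSpecification (fundamentalRep (Fin N)) ((N : ℝ) * β) E η)) / ((N : ℝ) / 2 - N * |β| * Λ₀) := by
  set γ := ymSpecification (fundamentalRep (Fin N)) ((N : ℝ) * β) E η with hγ
  set S : Cfg ↥E N → ℝ := fun Q => (N : ℝ) * β * regionRe (glueWith E Q (fun e' => ((η e' : SUN N) : Matrix (Fin N) (Fin N) ℂ))) E with hS
  set Z : ℝ := ∫ ζ, Real.exp (S (emb ζ)) ∂(haarPi ↥E N) with hZ
  have hSc : Continuous fun ζ : PSU ↥E N => S (emb ζ) := continuous_restrict (contDiff_regionPot_sun E η β hS)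
  have hZpos : 0 < Z := integral_exp_pos (integrable_of_continuous_PSU (Real.continuous_exp.comp hSc) _)
  have hFc : Continuous (matrixCylinder E f : LGConfig d (SUN N) → ℝ) := continuous_matrixCylinder_of_continuous E hf.continuous
  have hGc : Continuous (matrixCylinder E (Gam f f) : LGConfig d (SUN N) → ℝ) :=
    continuous_matrixCylinder_of_continuous E (contDiff_Gam hf hf).continuous
  have hglue : ∀ (u : Cfg ↥E N → ℝ) (ζ : PSU ↥E N), matrixCylinder E u (glueWith E ζ η) = u (emb ζ) := fun u ζ => by
    simp only [matrixCylinder]; congr 1; funext e; rw [glueWith_apply_mem E ζ η e.2, emb_apply]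
  set m : ℝ := (∫ ζ, Real.exp (S (emb ζ)) * f (emb ζ) ∂(haarPi ↥E N)) / Z with hm
  have hmean : ∫ U, matrixCylinder E f U ∂γ = m := by
    rw [hγ, integral_ymSpecification_eq_div_sun E η β hS hFc]
    simp only [hglue]
    rfl
  have hvar : Var[matrixCylinder E f; γ] = (∫ ζ, Real.exp (S (emb ζ)) * (f (emb ζ) - m) ^ 2 ∂(haarPi ↥E N)) / Z := by
    rw [variance_eq_integral hFc.measurable.aemeasurable, hmean, hγ,
      integral_ymSpecification_eq_div_sun E η β hS (F := fun U => (matrixCylinder E f U - m) ^ 2) ((hFc.sub continuous_const).pow 2)]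
    simp only [hglue]
    rfl
  have hG : ∫ U, matrixCylinder E (Gam f f) U ∂γ = (∫ ζ, Real.exp (S (emb ζ)) * Gam f f (emb ζ) ∂(haarPi ↥E N)) / Z := by
    rw [hγ, integral_ymSpecification_eq_div_sun E η β hS hGc]
    simp only [hglue]
    rfl
  have hP := poincare_gibbs (ι := ↥E) hN (regionPot_mem_polySpace_sun E η β hS) (hessBound_regionPot_sun E η β hH hS) hK hf
  rw [hvar, hG, div_div, div_le_div_iff₀ hZpos (mul_pos hZpos hK)]
  calc (∫ ζ, Real.exp (S (emb ζ)) * (f (emb ζ) - m) ^ 2 ∂(haarPi ↥E N)) * (Z * ((N : ℝ) / 2 - N * |β| * Λ₀))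
      = (((N : ℝ) / 2 - N * |β| * Λ₀) * ∫ ζ, Real.exp (S (emb ζ)) * (f (emb ζ) - m) ^ 2 ∂(haarPi ↥E N)) * Z := by ring
    _ ≤ (∫ ζ, Real.exp (S (emb ζ)) * Gam f f (emb ζ) ∂(haarPi ↥E N)) * Z := mul_le_mul_of_nonneg_right hP hZpos.le

/-- ★★★ **Kernel Poincaré inequality, Lipschitz form, EVERY region and boundary condition, every `SU(N)`, `d`, `Λ₀`**: for `K = N/2 − N|β|Λ₀ > 0` and
every smooth `f` that is `ℓ_e`-Lipschitz in the link `e` on `SU(N)^E` (Frobenius distance), `Var_{γ_E(·|η)}(f((U_e)_{e∈E})) ≤ (Σ_{e∈E} ℓ_e²)/K`.  Port of the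
unbuilt venture `RegionPoincare.kernel_variance_le`.  The Yang–Mills mass gap is NOT proved. [cite: ShenZhuZhu2022, Theorem 4.2, Remark 1.3] -/
theorem kernel_variance_le_sun {Λ₀ : ℝ} (hH : RegionWilsonHessianBound d N Λ₀) (hN : N ≠ 0) (β : ℝ)
    (hK : 0 < (N : ℝ) / 2 - N * |β| * Λ₀) {f : Cfg ↥E N → ℝ} (hf : ContDiff ℝ ∞ f) {ℓ : ↥E → ℝ} (hℓ : ∀ e, 0 ≤ ℓ e) (hLip : LinkLipschitz f ℓ) :
    Var[matrixCylinder E f; ymSpecification (fundamentalRep (Fin N)) ((N : ℝ) * β) E η] ≤ (∑ e, ℓ e ^ 2) / ((N : ℝ) / 2 - N * |β| * Λ₀) := by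
  have h := kernel_variance_le_integral_Gam_sun E η hH hN β hK hf
  refine h.trans (div_le_div_of_nonneg_right ?_ hK.le)
  haveI : IsProbabilityMeasure (ymSpecification (fundamentalRep (Fin N)) ((N : ℝ) * β) E η) :=
    Literature.MathematicalPhysics.QuantumLattice.isProbabilityMeasure_ymSpecification (fundamentalRep (Fin N))
      (continuous_fundamentalRep (n := Fin N)) _ E η
  have hpt : ∀ U : LGConfig d (SUN N), matrixCylinder E (Gam f f) U ≤ ∑ e, ℓ e ^ 2 := fun U =>
    Summit.Ventures.YMGap.LatticeBakryEmery.Gam_le_of_linkLipschitz hN hf hℓ hLip (fun e : ↥E => U e)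
  calc ∫ U, matrixCylinder E (Gam f f) U ∂(ymSpecification (fundamentalRep (Fin N)) ((N : ℝ) * β) E η)
      ≤ ∫ U, (∑ e, ℓ e ^ 2 : ℝ) ∂(ymSpecification (fundamentalRep (Fin N)) ((N : ℝ) * β) E η) :=
        integral_mono_of_nonneg (ae_of_all _ fun U => by
            show 0 ≤ Gam f f _; rw [Gam_self_eq_sum_linkFun]; exact Finset.sum_nonneg fun _ _ => Finset.sum_nonneg fun _ _ => sq_nonneg _)
          (integrable_const _) (ae_of_all _ hpt)
    _ = ∑ e, ℓ e ^ 2 := by simp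

/-- **`Γ(f,f)` is the sum of the Literature's `linkGradSq` over the links** at `SU(N)^E` configurations (left- versus right-invariant frame derivatives;
the case `Λ ↦ Λ`, identity projection, of G31's `Gam_cylinder_eq_sum_linkGradSq`).  Port of the unbuilt venture `Gam_eq_sum_linkGradSq`.
[cite: ShenZhuZhu2022, §2 (2.3)–(2.4)] -/
theorem Gam_eq_sum_linkGradSq_sun (hN : N ≠ 0) {f : Cfg ↥E N → ℝ} (hf : ContDiff ℝ ∞ f) (U : LGConfig d (SUN N)) :
    matrixCylinder E (Gam f f) U = ∑ e : ↥E, linkGradSq E f e (fun e' => ((U e'.1 : SUN N) : Matrix (Fin N) (Fin N) ℂ)) := by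
  classical
  set M : Cfg ↥E N := fun e' => ((U e'.1 : SUN N) : Matrix (Fin N) (Fin N) ℂ) with hM
  have hfd : Differentiable ℝ f := hf.differentiable (by simp)
  show Gam f f M = _
  rw [Gam_self_eq_sum_linkFun]
  refine Finset.sum_congr rfl fun e _ => ?_
  rw [linkGradSq_eq_sum_sq_fderiv E hfd e M]
  simp only [linkFun_apply, algD_apply]
  have hlk : ∀ Y : Matrix (Fin N) (Fin N) ℂ, M * lk e Y = Pi.single e (M e * Y) := by
    intro Y; funext e₂
    by_cases h : e₂ = e <;> [(subst h; simp [lk]); simp [lk, Pi.single_eq_of_ne h]]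
  simp only [hlk]
  set lam : Matrix (Fin N) (Fin N) ℂ →ₗ[ℝ] ℝ :=
    (fderiv ℝ f M).toLinearMap.comp (LinearMap.single ℝ (fun _ : ↥E => Matrix (Fin N) (Fin N) ℂ) e) with hlam
  have hlam_apply : ∀ A, lam A = fderiv ℝ f M (Pi.single e A) := fun A => rfl
  have hUe : M e ∈ Matrix.unitaryGroup (Fin N) ℂ := (U e.1).2.1
  have h := SUNBakryEmery.sum_sq_apply_frame_mul_eq_sum_sq_apply_mul_frame hN lam
    (Matrix.mem_unitaryGroup_iff.1 hUe) (Matrix.mem_unitaryGroup_iff'.1 hUe)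
  simp only [hlam_apply] at h
  exact h.symm

/-- ★★★ **Kernel Poincaré inequality in the PRINTED GRADIENT FORM (the Literature's `linkGradSq`, the currency of the named fact `bakryEmery_kernelLogSobolev`)**,
EVERY region and boundary condition, every `SU(N)`, `d`, `Λ₀`: for `K = N/2 − N|β|Λ₀ > 0` and every smooth `f`,
`Var_{γ_E(·|η)}(F) ≤ (Σ_{e∈E} ∫ |∇_e F|² dγ_E(·|η))/K` — the exact Poincaré analogue of `KernelLogSobolev`, hypothesis-free.  Port of the unbuilt venture
`kernel_variance_le_linkGradSq`.  The Yang–Mills mass gap is NOT proved. [cite: ShenZhuZhu2022, Theorem 4.2, Remark 1.3] -/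
theorem kernel_variance_le_linkGradSq_sun {Λ₀ : ℝ} (hH : RegionWilsonHessianBound d N Λ₀) (hN : N ≠ 0) (β : ℝ)
    (hK : 0 < (N : ℝ) / 2 - N * |β| * Λ₀) {f : Cfg ↥E N → ℝ} (hf : ContDiff ℝ ∞ f) :
    Var[matrixCylinder E f; ymSpecification (fundamentalRep (Fin N)) ((N : ℝ) * β) E η] ≤
      (∑ e : ↥E, ∫ U, linkGradSq E f e (fun e' => ((U e'.1 : SUN N) : Matrix (Fin N) (Fin N) ℂ))
          ∂(ymSpecification (fundamentalRep (Fin N)) ((N : ℝ) * β) E η)) / ((N : ℝ) / 2 - N * |β| * Λ₀) := by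
  have h := kernel_variance_le_integral_Gam_sun E η hH hN β hK hf
  haveI : IsProbabilityMeasure (ymSpecification (fundamentalRep (Fin N)) ((N : ℝ) * β) E η) :=
    Literature.MathematicalPhysics.QuantumLattice.isProbabilityMeasure_ymSpecification (fundamentalRep (Fin N))
      (continuous_fundamentalRep (n := Fin N)) _ E η
  have hfun : (matrixCylinder E (Gam f f) : LGConfig d (SUN N) → ℝ) =
      fun U => ∑ e : ↥E, linkGradSq E f e (fun e' => ((U e'.1 : SUN N) : Matrix (Fin N) (Fin N) ℂ)) :=
    funext fun U => Gam_eq_sum_linkGradSq_sun E hN hf U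
  have hc : ∀ e : ↥E, Continuous fun U : LGConfig d (SUN N) => linkGradSq E f e (fun e' => ((U e'.1 : SUN N) : Matrix (Fin N) (Fin N) ℂ)) :=
    fun e => (continuous_linkGradSq E hf e).comp (continuous_pi fun e' => continuous_subtype_val.comp (continuous_apply _))
  rw [hfun, integral_finsetSum _ fun e _ => (hc e).integrable_of_hasCompactSupport (HasCompactSupport.of_compactSpace _)] at h
  exact h

/-- ★★★ **THE SHARP WINDOW FOR THE KERNELS, every `SU(N)`, every `d`, EVERY finite region, EVERY boundary condition**: with the kernel regional Hessian
constant `Λ₀ = 4d` (§1), for `K = N/2 − 4dN|β| > 0` (`|β| < 1/(8d)`) and every smooth `f`: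
`Var_{γ_E(·|η)}(F) ≤ (Σ_{e∈E} ∫ |∇_e F|² dγ_E(·|η))/(N/2 − 4dN|β|)` and, for `f` `ℓ_e`-Lipschitz in the link `e`, `≤ (Σ_e ℓ_e²)/(N/2 − 4dN|β|)` — the uniform (in
volume AND boundary condition) Poincaré inequality of the DLR kernels, hypothesis-free.  HONEST FRAMING: strong coupling; no LSI, mixing, uniqueness or
mass-gap statement. [cite: ShenZhuZhu2022, Theorem 4.2, Remark 1.3] -/
theorem uniform_kernel_poincare_sharp_sun (hN : N ≠ 0) {β : ℝ} (hK : 0 < (N : ℝ) / 2 - N * |β| * (4 * d)) {f : Cfg ↥E N → ℝ} (hf : ContDiff ℝ ∞ f) :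
    Var[matrixCylinder E f; ymSpecification (fundamentalRep (Fin N)) ((N : ℝ) * β) E η] ≤
        (∑ e : ↥E, ∫ U, linkGradSq E f e (fun e' => ((U e'.1 : SUN N) : Matrix (Fin N) (Fin N) ℂ))
            ∂(ymSpecification (fundamentalRep (Fin N)) ((N : ℝ) * β) E η)) / ((N : ℝ) / 2 - N * |β| * (4 * d)) ∧
      ∀ {ℓ : ↥E → ℝ}, (∀ e, 0 ≤ ℓ e) → LinkLipschitz f ℓ →
        Var[matrixCylinder E f; ymSpecification (fundamentalRep (Fin N)) ((N : ℝ) * β) E η] ≤ (∑ e, ℓ e ^ 2) / ((N : ℝ) / 2 - N * |β| * (4 * d)) :=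
  ⟨kernel_variance_le_linkGradSq_sun E η (regionWilsonHessianBound_four_d_sun d N) hN β hK hf,
    fun hℓ hLip => kernel_variance_le_sun E η (regionWilsonHessianBound_four_d_sun d N) hN β hK hf hℓ hLip⟩

end Kernel

end Summit.QuantumFields.YangMills.Theorems.ColdStartUniversality

end
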